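import Summits.KontsevichZagierPeriods.KontsevichZagierPeriods.Theorems.HurwitzMicroSectorsHurwitzSectorComplementStubLadderEngineTStep
import Summits.KontsevichZagierPeriods.KontsevichZagierPeriods.Theorems.HurwitzMicroSectorsHurwitzSectorComplementStubLadderEngineUStep

/-!
# Crux `HurwitzSectorComplement` (stmt-KontsevichZagierPeriods-14341), line `chebyshev-level-deformation` —
# stub S1 `stub_ladderEngine`, BY NAME AND REGISTERED SIGNATURE

The ladder engine of the Chebyshev ladder in the half-angle coordinate `v = tan(u/2)`: with the rational
kernels

* `T(v,s) = ((1−s) − v²(1+s)) / ((1−s)² + v²(1+s)²) = Σ_{n≥1} cos(nu) s^{n−1}`,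
* `U(v,s) = 2v / ((1−s)² + v²(1+s)²) = Σ_{n≥1} sin(nu) s^{n−1}`, weight `ω(v) = 2/(1+v²)` (`du = ω dv`),

(the two generating series of `cos(nu)`, `sin(nu)`, i.e. real and imaginary part of
`Φ = e^{iu}/(1 − s e^{iu})`), the generating-series identity `∂_u Φ = i ∂_s (s Φ)` splits into the two
polynomial certificates `∂_v T = −ω ∂_s(sU)`, `∂_v U = ω ∂_s(sT)`, and these drive the two steps of the
ladder over a base `box^{m+2} × D`:

* **T-step** `[W·T(lam,p)] − [W/(1−p)] + [W·ω(y₀)·U(y₀,p′)] ∈ KZ.relations`,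
* **U-step** `[W·U(lam,p)] − [W·ω(y₀)·T(y₀,p′)] ∈ KZ.relations`,

`p` the product of the `m+2` box coordinates, `p′` of the remaining `m+1`, the new parameter
`y₀ ∈ (0, lam)` becoming the first coordinate of the parameter block.

Both steps are landed theorems of this directory (`ladderEngine_tStep`, file `…StubLadderEngineTStep`;
`ladderEngine_uStep`, file `…StubLadderEngineUStep` — two Newton–Leibniz moves with the rational
primitives, one coordinate swap, additivity, band integrability from the domination
`≤ C (1−p)^{−3/2} y₀^{−1/2}`). This file only assembles them into the stub `stub_ladderEngine` with the
signature registered for the line skeleton `Cruxes/HurwitzSectorComplement/Lines/chebyshev_level_deformation.lean`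
(conjunction T-step ∧ U-step), so that the skeleton's `sorry` is replaced by an import.

Source: M. Kontsevich, D. Zagier, *Periods* (2001), §1.2, rules (1)–(3) of the period calculus.
Nothing else is declared here.
-/

noncomputable section

open Set MeasureTheory
open scoped BigOperators
open Literature.NumberTheory.Transcendental

namespace Summit.KontsevichZagierPeriods.Theorems.HurwitzMicroSectorsHurwitzSectorComplement

/-- **S1, ladder engine** (registered stub of line `chebyshev-level-deformation`, crux
`HurwitzSectorComplement`). Over a base `box^{m+2} × D` (`D ⊆ ℝ^k` bounded `ℚ`-semialgebraic, bounded
semialgebraic weight `W`, semialgebraic parameter `0 < lam ≤ Λ`): the T-step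
`[W·T(lam,p)] ≡ [W/(1−p)] − [W·ω(y₀)·U(y₀,p′)]` and the U-step `[W·U(lam,p)] ≡ [W·ω(y₀)·T(y₀,p′)]`
modulo `KZ.relations`, the new parameter `y₀ ∈ (0, lam)` becoming the FIRST coordinate of the parameter
block and the last box coordinate being integrated out (`p′` = product of the remaining `m+1` box
coordinates); `T(v,s) = ((1−s) − v²(1+s))/((1−s)²+v²(1+s)²) = Σ cos(nu)s^{n−1}`,
`U(v,s) = 2v/((1−s)²+v²(1+s)²) = Σ sin(nu)s^{n−1}` (`v = tan(u/2)`), `ω(v) = 2/(1+v²)`; the steps are the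
move-level form of the generating-series identity `∂_uΦ = i∂_s(sΦ)`, `Φ = e^{iu}/(1−se^{iu})`, i.e. of the
certificates `∂_vT = −ω∂_s(sU)`, `∂_vU = ω∂_s(sT)`. Conjunction of the landed `ladderEngine_tStep` and
`ladderEngine_uStep`. [cite: KontsevichZagier2001, §1.2 rules (1)–(3)] -/
theorem stub_ladderEngine :
    (∀ (m k : ℕ) (D : Set (Fin k → ℝ)) (W lam : (Fin k → ℝ) → ℝ) (M Λ : ℝ),
      Literature.ModelTheory.ExponentialFields.IsSemialgebraic ℚ D → Bornology.IsBounded D →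
      IsSemialgebraicFunOn ℚ D W → IsSemialgebraicFunOn ℚ D lam →
      (∀ y ∈ D, |W y| ≤ M) → (∀ y ∈ D, 0 < lam y ∧ lam y ≤ Λ) →
      ∀ (r : KZ.IntegralRep (m + 2 + k)),
        r.domain = {z | (∀ i : Fin (m + 2), z (Fin.castAdd k i) ∈ Set.Ioo (0:ℝ) 1) ∧
          (fun j : Fin k => z (Fin.natAdd (m + 2) j)) ∈ D} →
        Set.EqOn r.integrand (fun z => W (fun j : Fin k => z (Fin.natAdd (m + 2) j)) *
          (((1 - ∏ i : Fin (m + 2), z (Fin.castAdd k i)) -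
              (lam (fun j : Fin k => z (Fin.natAdd (m + 2) j))) ^ 2 *
                (1 + ∏ i : Fin (m + 2), z (Fin.castAdd k i))) /
            ((1 - ∏ i : Fin (m + 2), z (Fin.castAdd k i)) ^ 2 +
              (lam (fun j : Fin k => z (Fin.natAdd (m + 2) j))) ^ 2 *
                (1 + ∏ i : Fin (m + 2), z (Fin.castAdd k i)) ^ 2))) r.domain →
        ∃ (r₁ : KZ.IntegralRep (m + 2 + k)) (r₂ : KZ.IntegralRep (m + 1 + (k + 1))),
          r₁.domain = r.domain ∧
          (r₁.integrand = fun z => W (fun j : Fin k => z (Fin.natAdd (m + 2) j)) /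
            (1 - ∏ i : Fin (m + 2), z (Fin.castAdd k i))) ∧
          r₂.domain = {z | (∀ i : Fin (m + 1), z (Fin.castAdd (k + 1) i) ∈ Set.Ioo (0:ℝ) 1) ∧
            (fun j : Fin k => z (Fin.natAdd (m + 1) j.succ)) ∈ D ∧
            0 < z (Fin.natAdd (m + 1) 0) ∧
            z (Fin.natAdd (m + 1) 0) < lam ((fun j : Fin k => z (Fin.natAdd (m + 1) j.succ)))} ∧
          (r₂.integrand = fun z => W ((fun j : Fin k => z (Fin.natAdd (m + 1) j.succ))) *
            (2 / (1 + (z (Fin.natAdd (m + 1) 0)) ^ 2)) *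
            (2 * z (Fin.natAdd (m + 1) 0) /
              ((1 - ∏ i : Fin (m + 1), z (Fin.castAdd (k + 1) i)) ^ 2 +
                (z (Fin.natAdd (m + 1) 0)) ^ 2 * (1 + ∏ i : Fin (m + 1), z (Fin.castAdd (k + 1) i)) ^ 2))) ∧
          KZ.of r - KZ.of r₁ + KZ.of r₂ ∈ KZ.relations) ∧
    (∀ (m k : ℕ) (D : Set (Fin k → ℝ)) (W lam : (Fin k → ℝ) → ℝ) (M Λ : ℝ),
      Literature.ModelTheory.ExponentialFields.IsSemialgebraic ℚ D → Bornology.IsBounded D →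
      IsSemialgebraicFunOn ℚ D W → IsSemialgebraicFunOn ℚ D lam →
      (∀ y ∈ D, |W y| ≤ M) → (∀ y ∈ D, 0 < lam y ∧ lam y ≤ Λ) →
      ∀ (r : KZ.IntegralRep (m + 2 + k)),
        r.domain = {z | (∀ i : Fin (m + 2), z (Fin.castAdd k i) ∈ Set.Ioo (0:ℝ) 1) ∧
          (fun j : Fin k => z (Fin.natAdd (m + 2) j)) ∈ D} →
        Set.EqOn r.integrand (fun z => W (fun j : Fin k => z (Fin.natAdd (m + 2) j)) *
          (2 * lam (fun j : Fin k => z (Fin.natAdd (m + 2) j)) /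
            ((1 - ∏ i : Fin (m + 2), z (Fin.castAdd k i)) ^ 2 +
              (lam (fun j : Fin k => z (Fin.natAdd (m + 2) j))) ^ 2 *
                (1 + ∏ i : Fin (m + 2), z (Fin.castAdd k i)) ^ 2))) r.domain →
        ∃ (r₂ : KZ.IntegralRep (m + 1 + (k + 1))),
          r₂.domain = {z | (∀ i : Fin (m + 1), z (Fin.castAdd (k + 1) i) ∈ Set.Ioo (0:ℝ) 1) ∧
            (fun j : Fin k => z (Fin.natAdd (m + 1) j.succ)) ∈ D ∧
            0 < z (Fin.natAdd (m + 1) 0) ∧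
            z (Fin.natAdd (m + 1) 0) < lam ((fun j : Fin k => z (Fin.natAdd (m + 1) j.succ)))} ∧
          (r₂.integrand = fun z => W ((fun j : Fin k => z (Fin.natAdd (m + 1) j.succ))) *
            (2 / (1 + (z (Fin.natAdd (m + 1) 0)) ^ 2)) *
            (((1 - ∏ i : Fin (m + 1), z (Fin.castAdd (k + 1) i)) -
                (z (Fin.natAdd (m + 1) 0)) ^ 2 * (1 + ∏ i : Fin (m + 1), z (Fin.castAdd (k + 1) i))) /
              ((1 - ∏ i : Fin (m + 1), z (Fin.castAdd (k + 1) i)) ^ 2 +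
                (z (Fin.natAdd (m + 1) 0)) ^ 2 * (1 + ∏ i : Fin (m + 1), z (Fin.castAdd (k + 1) i)) ^ 2))) ∧
          KZ.of r - KZ.of r₂ ∈ KZ.relations) :=
  ⟨ladderEngine_tStep, ladderEngine_uStep⟩

end Summit.KontsevichZagierPeriods.Theorems.HurwitzMicroSectorsHurwitzSectorComplement

end
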